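import Summits.Langlands.Langlands.Theorems.SqrtFiveQuarticCoversCertS3H12
import Summits.Langlands.Langlands.Theorems.SqrtFiveQuarticCoversCertS3H12AnchorsNonSquare
import HarnessLib

/-!
# Route `Langlands/SqrtFiveQuarticCovers`, certificate `CertS3H12` (sheet 4.7): KERNEL LIFT TESTS —
# none of the eleven exceptional quadratic-point classes of `Y₂ = X(s3,ns⁺5)` over `k = ℚ(√5)`
# lifts to the carrier `X = X(s3,H12)` over a totally real quartic field

Cell `pub/lg-quartmod` (F-L1), engine seat eng-4 g4 (item S3H12-Y2CENSUS).  Companion of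
`Theorems/SqrtFiveQuarticCoversCertS3H12.lean` (typ-3), `…CertS3H12WeakNF.lean` (eng-4 g3) and
`…CertS3H12AnchorsNonSquare.lean` (eng-4 g3), whose `ℚ(r)`-arithmetic it reuses.

## What this file is for

The tree theorem `certS3H12_of_modelIdentificationWeak_of_caseTwoEmpty_smooth (hNFw) (hDat')`
(p673359) closes `CertS3H12` modulo the model identification `hNFw` and the certified finite datum
`hDat'` = «CASE 2 EMPTY» on the cell's four-coordinate model `(t, n, ṽ, w)` of `X = X(s3,H12)`
(cubic `n³ = t³ + 2t² − 1` = 225a1, `ṽ² = M² + 12MD + 144D²` = the `X(s3)`-sheet, and the cell's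
`H12`-conic `(5 + 2r)·w² = 8t² − 12t + 7`).  The sibling file `…CertS3H12Y2Census.lean` re-types
that datum UPSTREAM as a POINT-CLASS LIST `hY2` on the genus-`3` curve `Y₂ = X(s3,ns⁺5)` — a curve
over `ℚ` cut out by Zywina's printed hauptmoduln `J₂`, `J₇` and 225a1 alone (coordinates `(t, n, ṽ)`;
no conic, no `w`): «over any quartic `K ∋ r`, `r² = 5`, a `K`-point of the `(t, n, ṽ)`-model with
`ṽ ≠ 0` has `(t, n) ∈ (ℚ + ℚr)²` or `t` satisfies one of ELEVEN explicit quadratic equations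
`t² + P_i(r′)·t + C_i(r′) = 0` over `ℚ + ℚr′`, `r′ = ±r`» (the eleven exceptional classes of the
cell's Y₂-census: eng-4 E8-POINTS / kit j315247 found ten, eng-5 R5-6E and eng-1 g2 the eleventh,
eng-5 R5-6F §1 (E) proved the list complete by the `β = 1 − ν₃` Prym sieve; cross-checked here:
the eleven `t`-minimal polynomials of this file = those of eng-5's `exceptional11-j317331.json` as a
set, up to `r ↦ −r` — eng-4 g4 `evidence/e8y2/y2census_classes.json`).

THIS file supplies the kernel half: for each class, a `K`-point of that class does NOT lie under a
point of `X` with coordinates in a totally real quartic `K`: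
* classes 1, 3, 7, 11 (`K_i = k(√Δ_i)` of signature `(0,2)` or `(2,1)`): `s := 2t + P_i` has
  `s² = Δ_i = δ₀ + δ₁r′` with `δ₀ + δ₁·(±√5) < 0` for a computable sign, so `K` is not totally real
  (`false_of_isTotallyReal_of_sq_eq`: an embedding `φ : K → ℂ` with `φ(r′) = ±√5` of the required
  sign exists by `NumberField.Embeddings.range_eval_eq_rootSet_minpoly`, and is real);
* classes 2, 4, 5, 6, 8, 9, 10 (totally real `K_i`): the LIFT TEST — the conic equation
  `(5 ± 2r)·w² = 8t² − 12t + 7` has no solution `w ∈ K`.  Proof pattern (`liftTest_core`):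
  `K = ℚ(r, s)` (`[K:ℚ] = 4`, `s ∉ ℚ(r)` by a non-square test, so `{1, r, s, rs}` is a `ℚ`-basis:
  `exists_kPair_eq_of_finrank_four`), `w = x + y·s` with `x, y ∈ ℚ(r)`; splitting along `{1, s}`
  gives `(5+2r)(x² + Δy²) = Q₀`, `2(5+2r)xy = Q₁` where `8t² − 12t + 7 = Q₀ + Q₁s`, hence
  `z := (5+2r)(x² − Δy²) ∈ ℚ(r)` has `z² = Q₀² − Δ·Q₁² = N_{K/ℚ(r)}(8t² − 12t + 7) =: N`; for six
  classes `N` is not a square in `ℚ(r)` (norm / half-norm / rational tests below), and for class 9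
  (`K = ℚ(√2, √5)`, `N = 49`) `z = ±7` forces `(5+2r)x² ∈ {9, 2}`, impossible in `ℚ(r)`.
  The conjugate conic `(5 − 2r)w² = q` reduces to the first by `w ↦ rw/(5+2r)` (`conic_conj`).
All constants were computed exactly (pure python, `code/y2census_classes.py`, cell HOME
`lg-quartmod-eng-4/evidence/e8y2/`); the kernel re-verifies every identity (`linear_combination`)
and every non-square claim (`norm_num` on explicit integers).

HONEST STATUS: support lemmas only (no hypothesis beyond the explicit equations, no definition, no
named fact); they close nothing on the ledger by themselves.  The COMPLETENESS of the eleven-class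
list (a Prym-sieve computation, N2) stays a NAMED input (`hY2` of the sibling file); «a certified
finite datum is not a modularity statement»; nothing here proves modularity of any elliptic curve.
References: cell files E8-POINTS.md (eng-4), R5-E8-CASE2-6D.md / R5-E8-Y2FORM-6F.md (eng-5);
[Zywina2015] arXiv:1508.07660 §1.2–1.3 (`J₂`, `J₇`); Cremona label 225a1.
-/

noncomputable section

set_option linter.dupNamespace false -- project-wide option; `Summit.Langlands.Langlands` is the mandated namespace

open scoped IntermediateField
open NumberField Polynomial

namespace Summit.Langlands.Langlands.Theorems.SqrtFiveQuarticCovers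

/-! ### §1 More non-squares in `k = ℚ(r)`, `r² = 5` (beyond the norm test of the anchors file) -/

/-- If `(c + d·r)² = a + b·r` and `a² − 5b² = m²` then `c² = (a + m)/2` or `c² = (a − m)/2`
(`c² + 5d² = a`, `2cd = b` give `(2c² − a)² = a² − 5b²`). [folklore] -/
theorem sq_eq_half_of_sq_eq {F : Type*} [Field F] [CharZero F] {r : F} (hr : r ^ 2 = 5)
    {a b c d m : ℚ} (hm : m ^ 2 = a ^ 2 - 5 * b ^ 2)
    (h : ((c : F) + (d : F) * r) ^ 2 = (a : F) + (b : F) * r) :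
    c ^ 2 = (a + m) / 2 ∨ c ^ 2 = (a - m) / 2 := by
  obtain ⟨h1, h2, -⟩ := isSquare_norm_of_sq_eq hr h
  have key : (2 * c ^ 2 - a) ^ 2 = m ^ 2 := by
    rw [hm, ← h1, ← h2]; ring
  rcases sq_eq_sq_iff_eq_or_eq_neg.mp key with h3 | h3
  · left; linarith
  · right; linarith

/-- **Half-norm test.**  If `a² − 5b² = m²` but neither `(a + m)/2` nor `(a − m)/2` is a rational
square, then `a + b·r` is not the square of any `c + d·r` (`c d : ℚ`). [folklore] -/
theorem not_sq_eq_of_not_isSquare_halves {F : Type*} [Field F] [CharZero F] {r : F} (hr : r ^ 2 = 5)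
    {a b : ℚ} (m : ℚ) (hm : m ^ 2 = a ^ 2 - 5 * b ^ 2) (hp : ¬ IsSquare ((a + m) / 2))
    (hn : ¬ IsSquare ((a - m) / 2)) (c d : ℚ) :
    ((c : F) + (d : F) * r) ^ 2 ≠ (a : F) + (b : F) * r := fun h => by
  rcases sq_eq_half_of_sq_eq hr hm h with hc | hc
  · exact hp ⟨c, by rw [← hc]; ring⟩
  · exact hn ⟨c, by rw [← hc]; ring⟩

/-- **Rational test.**  A rational `a` with neither `a` nor `5a` a rational square is not the square
of any `c + d·r` (`2cd = 0`: `d = 0` gives `c² = a`, `c = 0` gives `(5d)² = 5a`). [folklore] -/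
theorem not_sq_eq_ratCast {F : Type*} [Field F] [CharZero F] {r : F} (hr : r ^ 2 = 5) {a : ℚ}
    (h1 : ¬ IsSquare a) (h5 : ¬ IsSquare (5 * a)) (c d : ℚ) :
    ((c : F) + (d : F) * r) ^ 2 ≠ (a : F) := by
  intro h
  have h' : ((c : F) + (d : F) * r) ^ 2 = (a : F) + ((0 : ℚ) : F) * r := by
    rw [h]; push_cast; ring
  obtain ⟨ha, hb, -⟩ := isSquare_norm_of_sq_eq hr h'
  rcases mul_eq_zero.mp (show c * d = 0 by linarith) with hc | hd
  · subst hc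
    exact h5 ⟨5 * d, by rw [← ha]; ring⟩
  · subst hd
    exact h1 ⟨c, by rw [← ha]; ring⟩

/-- `5 + 2r ≠ 0` when `r² = 5`. [folklore] -/
theorem five_add_two_mul_ne_zero {F : Type*} [Field F] [CharZero F] {r : F} (hr : r ^ 2 = 5) :
    (5 : F) + 2 * r ≠ 0 := by
  intro h
  have h' : r = -5 / 2 := by linear_combination h / 2
  rw [h'] at hr
  norm_num at hr

/-- The conjugate conic reduces to the original one: `(5 − 2r)·w² = q ⇒ (5 + 2r)·(rw/(5+2r))² = q`
(`(5+2r)(5−2r) = 5 = r²`, so `5 − 2r ≡ 5 + 2r` modulo squares of `ℚ(r)`). [folklore] -/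
theorem conic_conj {F : Type*} [Field F] [CharZero F] {r w q : F} (hr : r ^ 2 = 5)
    (h : (5 - 2 * r) * w ^ 2 = q) : (5 + 2 * r) * (r * w / (5 + 2 * r)) ^ 2 = q := by
  have h52 := five_add_two_mul_ne_zero hr
  rw [div_pow, mul_pow, hr, ← h]
  field_simp
  linear_combination 4 * w ^ 2 * hr

/-! ### §2 Coordinates in `K = ℚ(r, s)` and the core of the lift test -/

/-- **`K = ℚ(r) ⊕ ℚ(r)·s`.**  In a number field `K` of degree `4` containing `r` (`r² = 5`) and an
element `s ∉ ℚ(r)`, the family `{1, r, s, rs}` is a `ℚ`-basis, so every `w ∈ K` is `x + y·s` with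
`x, y ∈ ℚ(r)`. [folklore] -/
theorem exists_kPair_eq_of_finrank_four {K : Type} [Field K] [NumberField K]
    (hd : Module.finrank ℚ K = 4) {r s : K} (hr : r ^ 2 = 5) (hs : s ∉ ℚ⟮r⟯) (w : K) :
    ∃ x ∈ ℚ⟮r⟯, ∃ y ∈ ℚ⟮r⟯, w = x + y * s := by
  let v : Fin 4 → K := ![1, r, s, r * s]
  have hv : LinearIndependent ℚ v := by
    rw [Fintype.linearIndependent_iff]
    intro g hg
    simp only [Fin.sum_univ_four, v, Matrix.cons_val_zero, Matrix.cons_val_one,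
      Matrix.cons_val_two, Matrix.cons_val_three, Matrix.head_cons, Matrix.tail_cons,
      Algebra.smul_def, eq_ratCast, mul_one] at hg
    have h23 : (g 2 : K) + (g 3 : K) * r = 0 := by
      by_contra hne
      apply hs
      have hs' : s = -((g 0 : K) + (g 1 : K) * r) / ((g 2 : K) + (g 3 : K) * r) := by
        rw [eq_div_iff hne]
        linear_combination hg
      rw [hs']
      exact div_mem (neg_mem (rat_add_rat_mul_mem_adjoin r _ _)) (rat_add_rat_mul_mem_adjoin r _ _)
    obtain ⟨h2, h3⟩ := ratCast_add_ratCast_mul_eq_zero hr h23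
    have h01 : (g 0 : K) + (g 1 : K) * r = 0 := by
      rw [h2, h3] at hg
      simpa using hg
    obtain ⟨h0, h1⟩ := ratCast_add_ratCast_mul_eq_zero hr h01
    intro i
    fin_cases i <;> assumption
  have hspan := hv.span_eq_top_of_card_eq_finrank (by rw [hd]; simp)
  have hw : w ∈ Submodule.span ℚ (Set.range v) := by rw [hspan]; exact Submodule.mem_top
  rw [Submodule.mem_span_range_iff_exists_fun] at hw
  obtain ⟨c, hc⟩ := hw
  simp only [Fin.sum_univ_four, v, Matrix.cons_val_zero, Matrix.cons_val_one,
    Matrix.cons_val_two, Matrix.cons_val_three, Matrix.head_cons, Matrix.tail_cons,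
    Algebra.smul_def, eq_ratCast, mul_one] at hc
  refine ⟨(c 0 : K) + (c 1 : K) * r, rat_add_rat_mul_mem_adjoin r _ _,
    (c 2 : K) + (c 3 : K) * r, rat_add_rat_mul_mem_adjoin r _ _, ?_⟩
  linear_combination -hc

/-- **Core of the lift test.**  Let `s² = Δ` with `Δ ∈ ℚ(r)`, `s ∉ ℚ(r)`, and suppose the conic
equation `(5 + 2r)(x + ys)² = Q₀ + Q₁s` holds with `x, y, Q₀, Q₁ ∈ ℚ(r)`.  Splitting along the
`ℚ(r)`-basis `{1, s}` of `ℚ(r, s)`: `(5+2r)(x² + Δy²) = Q₀`, `2(5+2r)xy = Q₁`, and therefore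
`z := (5+2r)(x² − Δy²) ∈ ℚ(r)` satisfies `z² = Q₀² − Δ·Q₁²` (the relative norm of `Q₀ + Q₁s`).
[folklore] -/
theorem liftTest_core {K : Type} [Field K] [CharZero K] {r s Δ x y Q₀ Q₁ : K}
    (hs : s ^ 2 = Δ) (hsk : s ∉ ℚ⟮r⟯) (hΔ : Δ ∈ ℚ⟮r⟯) (hx : x ∈ ℚ⟮r⟯) (hy : y ∈ ℚ⟮r⟯)
    (hQ₀ : Q₀ ∈ ℚ⟮r⟯) (hQ₁ : Q₁ ∈ ℚ⟮r⟯)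
    (h : (5 + 2 * r) * (x + y * s) ^ 2 = Q₀ + Q₁ * s) :
    (5 + 2 * r) * (x ^ 2 + Δ * y ^ 2) = Q₀ ∧ 2 * (5 + 2 * r) * x * y = Q₁ ∧
      ((5 + 2 * r) * (x ^ 2 - Δ * y ^ 2)) ^ 2 = Q₀ ^ 2 - Δ * Q₁ ^ 2 ∧
      (5 + 2 * r) * (x ^ 2 - Δ * y ^ 2) ∈ ℚ⟮r⟯ := by
  have hr_mem : r ∈ ℚ⟮r⟯ := IntermediateField.mem_adjoin_simple_self ℚ r
  have h52 : (5 : K) + 2 * r ∈ ℚ⟮r⟯ :=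
    add_mem (ofNat_mem _ 5) (mul_mem (ofNat_mem _ 2) hr_mem)
  have hαβ : ((5 + 2 * r) * (x ^ 2 + Δ * y ^ 2) - Q₀) + (2 * (5 + 2 * r) * x * y - Q₁) * s = 0 := by
    linear_combination h - (5 + 2 * r) * y ^ 2 * hs
  have hα_mem : (5 + 2 * r) * (x ^ 2 + Δ * y ^ 2) - Q₀ ∈ ℚ⟮r⟯ :=
    sub_mem (mul_mem h52 (add_mem (pow_mem hx 2) (mul_mem hΔ (pow_mem hy 2)))) hQ₀
  have hβ_mem : 2 * (5 + 2 * r) * x * y - Q₁ ∈ ℚ⟮r⟯ :=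
    sub_mem (mul_mem (mul_mem (mul_mem (ofNat_mem _ 2) h52) hx) hy) hQ₁
  have hβ : 2 * (5 + 2 * r) * x * y - Q₁ = 0 := by
    by_contra hne
    apply hsk
    have hs' : s = -((5 + 2 * r) * (x ^ 2 + Δ * y ^ 2) - Q₀) / (2 * (5 + 2 * r) * x * y - Q₁) := by
      rw [eq_div_iff hne]
      linear_combination hαβ
    rw [hs']
    exact div_mem (neg_mem hα_mem) hβ_mem
  have hα : (5 + 2 * r) * (x ^ 2 + Δ * y ^ 2) - Q₀ = 0 := by
    have h' := hαβ
    rw [hβ, zero_mul, add_zero] at h'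
    exact h'
  have e1 : (5 + 2 * r) * (x ^ 2 + Δ * y ^ 2) = Q₀ := by linear_combination hα
  have e2 : 2 * (5 + 2 * r) * x * y = Q₁ := by linear_combination hβ
  refine ⟨e1, e2, ?_, mul_mem h52 (sub_mem (pow_mem hx 2) (mul_mem hΔ (pow_mem hy 2)))⟩
  linear_combination ((5 + 2 * r) * (x ^ 2 + Δ * y ^ 2) + Q₀) * e1
    - Δ * (2 * (5 + 2 * r) * x * y + Q₁) * e2

/-- A rational number lies in `ℚ⟮r⟯`. [folklore] -/
theorem ratCast_mem_adjoin {K : Type} [Field K] [CharZero K] (r : K) (a : ℚ) : (a : K) ∈ ℚ⟮r⟯ := by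
  rw [← eq_ratCast (algebraMap ℚ K) a]
  exact ℚ⟮r⟯.algebraMap_mem a

/-- A rational multiple of `r` lies in `ℚ⟮r⟯`. [folklore] -/
theorem ratCast_mul_mem_adjoin {K : Type} [Field K] [CharZero K] (r : K) (b : ℚ) :
    (b : K) * r ∈ ℚ⟮r⟯ :=
  mul_mem (ratCast_mem_adjoin r b) (IntermediateField.mem_adjoin_simple_self ℚ r)

/-! ### §3 Totally real fields contain no `s` with `s² = δ₀ + δ₁r` of a negative conjugate -/

/-- A number field containing `r` with `r² = 5` has a complex embedding sending `r` to `+√5` and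
one sending `r` to `−√5` (the roots of `minpoly_ℚ r = X² − 5`;
`NumberField.Embeddings.range_eval_eq_rootSet_minpoly`). [folklore] -/
theorem exists_embedding_map_eq_sqrt_five {K : Type} [Field K] [NumberField K] {r : K}
    (hr : r ^ 2 = 5) (ε : ℝ) (hε : ε = 1 ∨ ε = -1) :
    ∃ φ : K →+* ℂ, φ r = ((ε * Real.sqrt 5 : ℝ) : ℂ) := by
  have h5 : (ε * Real.sqrt 5) ^ 2 = (5 : ℝ) := by
    have hs : Real.sqrt 5 ^ 2 = 5 := Real.sq_sqrt (by norm_num)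
    rcases hε with rfl | rfl <;> nlinarith [hs]
  have hmem : ((ε * Real.sqrt 5 : ℝ) : ℂ) ∈ (minpoly ℚ r).rootSet ℂ := by
    rw [minpoly_eq_X_sq_sub_five hr, Polynomial.mem_rootSet]
    refine ⟨(monic_X_pow_sub_C (5 : ℚ) two_ne_zero).ne_zero, ?_⟩
    simp only [map_sub, map_pow, aeval_X, aeval_C, eq_ratCast]
    have h5' : (((ε * Real.sqrt 5) ^ 2 : ℝ) : ℂ) = ((5 : ℝ) : ℂ) := by rw [h5]
    push_cast at h5' ⊢
    rw [h5']; ring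
  rw [← NumberField.Embeddings.range_eval_eq_rootSet_minpoly K ℂ r] at hmem
  obtain ⟨φ, hφ⟩ := hmem
  exact ⟨φ, hφ⟩

/-- **Total reality obstruction.**  If `K` is totally real, `r² = 5`, and `s² = δ₀ + δ₁·r` in `K`
with `δ₀ + δ₁·ε√5 < 0` for `ε = 1` or `ε = −1`, contradiction: the real embedding `ψ` with
`ψ(r) = ε√5` gives `ψ(s)² < 0`. [folklore] -/
theorem false_of_isTotallyReal_of_sq_eq {K : Type} [Field K] [NumberField K] [IsTotallyReal K]
    {r s : K} (hr : r ^ 2 = 5) {δ₀ δ₁ : ℚ} (hs : s ^ 2 = (δ₀ : K) + (δ₁ : K) * r) (ε : ℝ)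
    (hε : ε = 1 ∨ ε = -1) (hneg : (δ₀ : ℝ) + δ₁ * (ε * Real.sqrt 5) < 0) : False := by
  obtain ⟨φ, hφr⟩ := exists_embedding_map_eq_sqrt_five hr ε hε
  have hφ : ComplexEmbedding.IsReal φ :=
    NumberField.InfinitePlace.isReal_mk_iff.mp (IsTotallyReal.isReal _)
  have hψ : ∀ x : K, ((hφ.embedding x : ℝ) : ℂ) = φ x := hφ.coe_embedding_apply
  have hψr : hφ.embedding r = ε * Real.sqrt 5 := by
    have h := hψ r
    rw [hφr] at h
    exact_mod_cast h
  have hψs : (hφ.embedding s) ^ 2 = δ₀ + δ₁ * (ε * Real.sqrt 5) := by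
    have h := congrArg hφ.embedding hs
    simp only [map_pow, map_add, map_mul, map_ratCast] at h
    rw [h, hψr]
  nlinarith [sq_nonneg (hφ.embedding s)]

/-! ### §4 The four classes over fields that are not totally real -/

/-- **Class 1** (j=-32768, K disc 5^2 11^2, sig (0,2)): `t² + P·t + C = 0` with `P = 7/2`, `C = 13/2`;
`(2t + P)² = Δ = -55/4`, and `Δ` is negative under the embedding `r ↦ +√5`, so no
totally real `K ∋ r` contains such a `t`. [folklore] -/
theorem y2class01_not_totallyReal {K : Type} [Field K] [NumberField K] [IsTotallyReal K]
    {r t : K} (hr : r ^ 2 = 5) (ht : t ^ 2 + ((7/2 : ℚ) : K) * t + ((13/2 : ℚ) : K) = 0) : False := by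
  have hs : (2 * t + ((7/2 : ℚ) : K)) ^ 2 = ((-55/4 : ℚ) : K) + ((0 : ℚ) : K) * r := by
    push_cast at ht ⊢
    linear_combination 4 * ht
  exact false_of_isTotallyReal_of_sq_eq hr hs 1 (Or.inl rfl) (by
    norm_num)

/-- **Class 3** (j=-32768, K disc -5^3 11, sig (2,1)): `t² + P·t + C = 0` with `P = (-1/14 + (3/7)*r)`, `C = (1/14 + (-1/7)*r)`;
`(2t + P)² = Δ = (125/196 + (25/49)*r)`, and `Δ` is negative under the embedding `r ↦ −√5`, so no
totally real `K ∋ r` contains such a `t`. [folklore] -/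
theorem y2class03_not_totallyReal {K : Type} [Field K] [NumberField K] [IsTotallyReal K]
    {r t : K} (hr : r ^ 2 = 5) (ht : t ^ 2 + (((-1/14 : ℚ) : K) + ((3/7 : ℚ) : K) * r) * t + (((1/14 : ℚ) : K) + ((-1/7 : ℚ) : K) * r) = 0) : False := by
  have hs : (2 * t + (((-1/14 : ℚ) : K) + ((3/7 : ℚ) : K) * r)) ^ 2 = ((125/196 : ℚ) : K) + ((25/49 : ℚ) : K) * r := by
    push_cast at ht ⊢
    linear_combination 4 * ht + (9/49 : K) * hr
  exact false_of_isTotallyReal_of_sq_eq hr hs (-1) (Or.inr rfl) (by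
    have h5 : ((5/4 : ℚ) : ℝ) < Real.sqrt 5 := by
      rw [Real.lt_sqrt (by norm_num)]; norm_num
    push_cast at h5 ⊢
    nlinarith [h5])

/-- **Class 7** (K disc -5^2 239, sig (2,1)): `t² + P·t + C = 0` with `P = -1/2`, `C = (-1/2 + (1/2)*r)`;
`(2t + P)² = Δ = (9/4 + (-2)*r)`, and `Δ` is negative under the embedding `r ↦ +√5`, so no
totally real `K ∋ r` contains such a `t`. [folklore] -/
theorem y2class07_not_totallyReal {K : Type} [Field K] [NumberField K] [IsTotallyReal K]
    {r t : K} (hr : r ^ 2 = 5) (ht : t ^ 2 + ((-1/2 : ℚ) : K) * t + (((-1/2 : ℚ) : K) + ((1/2 : ℚ) : K) * r) = 0) : False := by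
  have hs : (2 * t + ((-1/2 : ℚ) : K)) ^ 2 = ((9/4 : ℚ) : K) + ((-2 : ℚ) : K) * r := by
    push_cast at ht ⊢
    linear_combination 4 * ht
  exact false_of_isTotallyReal_of_sq_eq hr hs 1 (Or.inl rfl) (by
    have h5 : ((9/8 : ℚ) : ℝ) < Real.sqrt 5 := by
      rw [Real.lt_sqrt (by norm_num)]; norm_num
    push_cast at h5 ⊢
    nlinarith [h5])

/-- **Class 11** (the 11th class (R5-6E / eng-1 g2), K disc -5^2 71, sig (2,1)): `t² + P·t + C = 0` with `P = (-983/662 + (527/662)*r)`, `C = (379/331 + (-317/331)*r)`;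
`(2t + P)² = Δ = (173875/219122 + (321375/219122)*r)`, and `Δ` is negative under the embedding `r ↦ −√5`, so no
totally real `K ∋ r` contains such a `t`. [folklore] -/
theorem y2class11_not_totallyReal {K : Type} [Field K] [NumberField K] [IsTotallyReal K]
    {r t : K} (hr : r ^ 2 = 5) (ht : t ^ 2 + (((-983/662 : ℚ) : K) + ((527/662 : ℚ) : K) * r) * t + (((379/331 : ℚ) : K) + ((-317/331 : ℚ) : K) * r) = 0) : False := by
  have hs : (2 * t + (((-983/662 : ℚ) : K) + ((527/662 : ℚ) : K) * r)) ^ 2 = ((173875/219122 : ℚ) : K) + ((321375/219122 : ℚ) : K) * r := by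
    push_cast at ht ⊢
    linear_combination 4 * ht + (277729/438244 : K) * hr
  exact false_of_isTotallyReal_of_sq_eq hr hs (-1) (Or.inr rfl) (by
    have h5 : ((1391/2571 : ℚ) : ℝ) < Real.sqrt 5 := by
      rw [Real.lt_sqrt (by norm_num)]; norm_num
    push_cast at h5 ⊢
    nlinarith [h5])

end Summit.Langlands.Langlands.Theorems.SqrtFiveQuarticCovers

end
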